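import Mathlib
import Summits.ResolutionOfSingularities.ResolutionOfSingularities.Theorems.RadicialJungCleanModelsBestApproxCleanZpow
import Summits.ResolutionOfSingularities.ResolutionOfSingularities.Theorems.ValuativeLuAlphaPTorsorTowerModel
import Literature.AlgebraicGeometry.Resolution.MonomializationAlongValuation
import Literature.AlgebraicGeometry.Resolution.LocalBlowup
import Literature.AlgebraicGeometry.Resolution.ExcellentRings
import Literature.AlgebraicGeometry.Resolution.ExcellentRingsEssFiniteType
import Literature.AlgebraicGeometry.Resolution.ExcellentRingsFieldProofs
import Literature.AlgebraicGeometry.Resolution.ArithmeticalThreefoldsMonomials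
import HarnessLib

/-!
# Route `RadicialJung`, crux `CleanModels` (stmt-15917), stub `stub_cleanLU3`: **clean local uniformization at
# 3-dimensional centres for DEFECTLESS valuations**, modulo embedded resolution of surfaces in regular excellent threefolds

Line `Sketch` rev 16 of crux stmt-ResolutionOfSingularities-15917 (memo `Cruxes/CleanModels/Lines/Sketch-memo-open-stubs.md` §2;
lead `res-B-lead-1` g2).  OURS; nothing here proves resolution in characteristic `p`, and the DEFECT case of `stub_cleanLU3`
(valuations at which the `K^p`-line of `g₀` is immediate) is NOT treated here.

Setting of `stub_cleanLU3`: `k` a field of characteristic `p`, `K ⊇ k` a function field, `O` a valuation ring of `K`, `A ⊆ O`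
a finitely generated affine model of `K` whose local ring `S = A_{𝔪_O ∩ A}` (`locAtCentre A O`) is regular of dimension `3`,
`g₀ ∈ K`.  HYPOTHESES of this file: (a) embedded resolution of two-dimensional closed subsets of regular excellent schemes
(`hEmb`, the shape used by `Literature/…/MonomializationAlongValuation.lean`; Cossart–Jannsen–Saito 2020, Cor. 1.5), and
(b) a BEST `p`-TH-POWER APPROXIMATION `f₀` of `g₀` for the valuation `v` of `O` (`v (g₀ - f₀^p)` minimal), which exists exactly
when the `K^p`-line of `g₀` is defectless at `v` (`…BestApproxClean`: ramified / inert witnesses).  CONCLUSION: that of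
`stub_cleanLU3` — a finitely generated `A ⊆ A' ⊆ O`, regular at the centre of `O`, carrying there a loosely clean non-trivial
representative of the `K^p`-line of `g₀`.

Proof: `S` is excellent (localisation of a finitely generated `k`-algebra); write `g₀ - f₀^p = x / y` (`x, y ∈ A`) and
monomialize `x · y · s` (`s ∈ 𝔪_S ∖ 0`) along `v` by `exists_localRing_monomial_of_embeddedResolution` (`hEmb`): a regular local
`R' ↪ K` dominated by `O`, the local ring at the centre of `O` of `A' = A[u]` (`u ⊆ K` finite), in which `x y s` is a unit times
a monomial in a regular system of parameters; divisors of such are again units times monomials (`IsRsopPart.prime`,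
`CossartPiltantMonomial.exists_eq_units_mul_prod_pow_of_dvd`), so `g₀ - f₀^p` is a unit times a LAURENT monomial, and the
read-off `cleanRegAt_of_isMin_pthPowerApprox_zpow` (✓ `…BestApproxCleanZpow`) gives `CleanRegAt` at `R' = locAtCentre A' O`.
-/

noncomputable section

set_option linter.dupNamespace false -- mandated namespace of this single-conjunct summit

open IsLocalRing AlgebraicGeometry CategoryTheory
open Literature.AlgebraicGeometry.Resolution

namespace Summit.ResolutionOfSingularities.ResolutionOfSingularities.Theorems.RadicialJung.CleanModels

variable {K : Type} [Field K]

/-! ## Transport of regular-local data to the image of an embedding -/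

/-- The image of a regular local ring under an injective ring map into a field is a regular local ring (a subring), with the
image of a regular system of parameters a regular system of parameters, the same dimension, and units going to units.
[folklore] -/
theorem regular_data_of_range_eq {R' : Type} [CommRing R'] [IsRegularLocalRing R'] (φ : R' →+* K)
    (hφ : Function.Injective φ) (R₂ : Subring K) (hR₂ : φ.range = R₂) {d : ℕ} (z : Fin d → R')
    (hz : Ideal.span (Set.range z) = maximalIdeal R') (hd : ringKrullDim R' = d) (u : R') (hu : IsUnit u) :
    ∃ (_ : IsRegularLocalRing R₂) (z₂ : Fin d → R₂) (u₂ : R₂), (∀ i, (z₂ i : K) = φ (z i)) ∧ (u₂ : K) = φ u ∧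
      Ideal.span (Set.range z₂) = maximalIdeal R₂ ∧ ringKrullDim R₂ = d ∧ IsUnit u₂ := by
  subst hR₂
  let e : R' ≃+* φ.range :=
    RingEquiv.ofBijective φ.rangeRestrict ⟨fun x y h => hφ (congrArg Subtype.val h), φ.rangeRestrict_surjective⟩
  have he : ∀ r : R', ((e r : φ.range) : K) = φ r := fun r => rfl
  haveI hreg : IsRegularLocalRing φ.range := IsRegularLocalRing.of_ringEquiv e
  refine ⟨hreg, fun i => e (z i), e u, fun i => he (z i), he u, ?_, ?_, hu.map e⟩
  · rw [← map_ringEquiv_maximalIdeal e, ← hz, Ideal.map_span, ← Set.range_comp]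
    rfl
  · rw [← ringKrullDim_eq_of_ringEquiv e, hd]

/-- The image of a local ring `R' ↪ K` dominated by `O` which contains `T` and consists of fractions `τ/σ`, `τ, σ ∈ T`,
`v σ = 1`, is the local ring `locAtCentre T O` of `T` at the centre of `O`. [folklore] -/
theorem range_eq_locAtCentre {R' : Type} [CommRing R'] [IsLocalRing R'] (φ : R' →+* K) (O : ValuationSubring K)
    (T : Subring K) (hTR : ∀ y ∈ T, y ∈ Set.range φ)
    (hm : ∀ r : R', r ∈ maximalIdeal R' ↔ O.valuation (φ r) < 1)
    (hup : ∀ r : R', ∃ τ σ : K, τ ∈ T ∧ σ ∈ T ∧ O.valuation σ = 1 ∧ φ r * σ = τ) :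
    φ.range = locAtCentre T O := by
  refine le_antisymm ?_ ?_
  · rintro _ ⟨r, rfl⟩
    obtain ⟨τ, σ, hτ, hσ, hv, hr⟩ := hup r
    refine ⟨τ, hτ, σ, hσ, hv, ?_⟩
    rw [← hr, mul_div_cancel_right₀ _ (ne_zero_of_valuation_eq_one hv)]
  · rintro _ ⟨y, hy, z, hz, hv, rfl⟩
    obtain ⟨y', hy'⟩ := hTR y hy
    obtain ⟨z', hz'⟩ := hTR z hz
    have hunit : IsUnit z' := by
      by_contra hcon
      have hmem : z' ∈ maximalIdeal R' := hcon
      rw [hm, hz', hv] at hmem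
      exact lt_irrefl _ hmem
    obtain ⟨w, hw⟩ := hunit
    refine ⟨y' * ↑w⁻¹, ?_⟩
    rw [map_mul, hy', div_eq_mul_inv]
    congr 1
    have h1 : φ z' * φ ↑w⁻¹ = 1 := by rw [← map_mul, ← hw, Units.mul_inv, map_one]
    rw [hz'] at h1
    exact (eq_inv_of_mul_eq_one_right h1)

/-! ## Unfolding `CleanRegAt` through a subring inclusion -/

/-- `LooseCleanForm` read through the inclusion `R ⊆ K`, written with coercions (the three-form disjunction of
`stub_cleanLU3`). [folklore] -/
theorem forms_of_looseCleanForm {p : ℕ} {R : Subring K} [IsRegularLocalRing R] {X : K} (h : LooseCleanForm p R.subtype X) :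
    (∃ (d m : ℕ) (hmd : m ≤ d) (t : Fin d → R) (a : Fin m → ℕ) (u : R), IsUnit u ∧
        Ideal.span (Set.range t) = maximalIdeal R ∧ ringKrullDim R = (d : WithBot ℕ∞) ∧ 0 < m ∧ (∀ i, ¬ p ∣ a i) ∧
        X = (u : K) * ∏ i : Fin m, ((t (Fin.castLE hmd i) : R) : K) ^ (a i)) ∨
      (∃ u : R, IsUnit u ∧ X = (u : K) ∧ ∀ c' : R, u - c' ^ p ∉ maximalIdeal R) ∨
      (∃ s c' : R, X = (s : K) ∧ s - c' ^ p ∈ maximalIdeal R ∧ s - c' ^ p ∉ maximalIdeal R ^ 2) := by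
  rcases h with ⟨d, m, hmd, t, a, u, hu, hspan, hdim, hm, ha, hX⟩ | ⟨u, hu, hX, hc⟩ | ⟨s, c', hX, h1, h2⟩
  · refine Or.inl ⟨d, m, hmd, t, a, u, hu, hspan, hdim, hm, ha, ?_⟩
    rw [hX, map_mul, map_prod]
    simp only [map_pow, Subring.coe_subtype]
  · exact Or.inr (Or.inl ⟨u, hu, hX, hc⟩)
  · exact Or.inr (Or.inr ⟨s, c', hX, h1, h2⟩)

/-! ## The defectless half of `stub_cleanLU3` -/

/-- **Clean local uniformization at a 3-dimensional centre, for a valuation admitting a best `p`-th-power approximation of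
`g₀`, modulo embedded resolution of surfaces in regular excellent schemes** (CJS Cor. 1.5, hypothesis `hEmb`).  The
conclusion is that of the registered stub `stub_cleanLU3` of `Cruxes/CleanModels/Lines/Sketch.lean` rev 16, verbatim.
[cite: CossartJannsenSaito2020, Cor. 1.5, p. 7] -/
theorem cleanLU3_of_isMin_pthPowerApprox
    (hEmb : ∀ (Z : Scheme.{0}) [IsIntegral Z] [IsNoetherian Z], Scheme.IsRegular Z →
      Scheme.IsExcellent Z → ∀ (X : Set Z), IsClosed X → X ≠ Set.univ → topologicalKrullDim X ≤ 2 →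
        ∃ (Z' : Scheme.{0}) (π : Z' ⟶ Z), IsProper π ∧ Function.Surjective π.base ∧
          (∃ U : Z.Opens, (U : Set Z) = Xᶜ ∧ IsIso (π ∣_ U)) ∧
          IsStrictNormalCrossingsDivisor Z' (π.base ⁻¹' X))
    (p : ℕ) (hp : p.Prime) (k : Type) [Field k] [CharP k p] (K : Type) [Field K] [Algebra k K]
    (O : ValuationSubring K) (A : Subalgebra k K) (hAO : A.toSubring ≤ O.toSubring) (hAfg : A.FG)
    (hfrac : IsFractionRing A K)
    (hreg : IsRegularLocalRing (locAtCentre A.toSubring O))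
    (hdim3 : ringKrullDim (locAtCentre A.toSubring O) = 3)
    (g₀ : K) (hg₀ : ∀ c : K, c ^ p ≠ g₀)
    (f₀ : K) (hmin : ∀ f : K, O.valuation (g₀ - f₀ ^ p) ≤ O.valuation (g₀ - f ^ p)) :
    ∃ (A' : Subalgebra k K), A'.toSubring ≤ O.toSubring ∧ A ≤ A' ∧ A'.FG ∧
      ∃ (_ : IsRegularLocalRing (locAtCentre A'.toSubring O)) (c : Fin p → K),
        (∃ j : Fin p, (j : ℕ) ≠ 0 ∧ c j ≠ 0) ∧
        ((∃ (d m : ℕ) (hmd : m ≤ d) (t : Fin d → ↥(locAtCentre A'.toSubring O)) (a : Fin m → ℕ)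
            (u : ↥(locAtCentre A'.toSubring O)), IsUnit u ∧
            Ideal.span (Set.range t) = IsLocalRing.maximalIdeal ↥(locAtCentre A'.toSubring O) ∧
            ringKrullDim ↥(locAtCentre A'.toSubring O) = (d : WithBot ℕ∞) ∧ 0 < m ∧ (∀ i, ¬ p ∣ a i) ∧
            (∑ j : Fin p, c j ^ p * g₀ ^ (j : ℕ)) =
              (u : K) * ∏ i : Fin m, ((t (Fin.castLE hmd i) : ↥(locAtCentre A'.toSubring O)) : K) ^ (a i)) ∨
          (∃ u : ↥(locAtCentre A'.toSubring O), IsUnit u ∧ (∑ j : Fin p, c j ^ p * g₀ ^ (j : ℕ)) = (u : K) ∧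
            ∀ c' : ↥(locAtCentre A'.toSubring O), u - c' ^ p ∉ IsLocalRing.maximalIdeal ↥(locAtCentre A'.toSubring O)) ∨
          (∃ s c' : ↥(locAtCentre A'.toSubring O), (∑ j : Fin p, c j ^ p * g₀ ^ (j : ℕ)) = (s : K) ∧
            s - c' ^ p ∈ IsLocalRing.maximalIdeal ↥(locAtCentre A'.toSubring O) ∧
            s - c' ^ p ∉ IsLocalRing.maximalIdeal ↥(locAtCentre A'.toSubring O) ^ 2)) := by
  classical
  haveI : Fact p.Prime := ⟨hp⟩
  haveI := hreg
  set S : Subring K := locAtCentre A.toSubring O with hSdef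
  have hSO : S ≤ O.toSubring := locAtCentre_le hAO
  have hAS : A.toSubring ≤ S := le_locAtCentre A.toSubring O
  haveI : CharP K p := charP_of_injective_algebraMap (algebraMap k K).injective p
  haveI : IsDomain S := inferInstance
  -- `S` is excellent: a localisation of the finitely generated `k`-algebra `A`
  haveI : Algebra.FiniteType k A := (Subalgebra.fg_iff_finiteType A).mp hAfg
  have hexcA : IsExcellentRing A := isExcellentRing_of_finiteType_field k A
  haveI := isLocalization_locAtCentre (K := K) (O := O) hAO
  have hexcS : IsExcellentRing S :=
    IsExcellentRing.of_isLocalization (A := A.toSubring) (B := S) (subringCentre A.toSubring O hAO).primeCompl hexcA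
  -- the remainder `r = g₀ - f₀^p = x / y`, `x, y ∈ A`, and a nonzero `s ∈ 𝔪_S`
  have hr0 : g₀ - f₀ ^ p ≠ 0 := fun h => hg₀ f₀ (sub_eq_zero.mp h).symm
  obtain ⟨x, y, hy, hxy⟩ := IsFractionRing.div_surjective (A := A) (g₀ - f₀ ^ p)
  have hy0 : (y : K) ≠ 0 := by
    intro h
    have : (y : A) = 0 := Subtype.ext h
    exact (nonZeroDivisors.ne_zero hy) this
  have hxy' : (x : K) / (y : K) = g₀ - f₀ ^ p := hxy
  have hx0 : (x : K) ≠ 0 := by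
    intro h
    apply hr0
    rw [← hxy', h, zero_div]
  have hmne : maximalIdeal S ≠ ⊥ := by
    intro hbot
    have hfield : IsField S := IsLocalRing.isField_iff_maximalIdeal_eq.mpr hbot
    have h0 : ringKrullDim S = 0 := ringKrullDim_eq_zero_of_isField hfield
    have h3 : ringKrullDim S = 3 := hdim3
    rw [h0] at h3
    exact absurd h3 (by decide)
  obtain ⟨s, hsm, hs0⟩ := Submodule.exists_mem_ne_zero_of_ne_bot hmne
  let xS : S := ⟨x, hAS x.2⟩
  let yS : S := ⟨y, hAS y.2⟩
  let xR : S := xS * yS * s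
  have hxR0 : xR ≠ 0 := by
    refine mul_ne_zero (mul_ne_zero ?_ ?_) hs0
    · exact fun h => hx0 (congrArg Subtype.val h)
    · exact fun h => hy0 (congrArg Subtype.val h)
  have hxRm : xR ∈ maximalIdeal S := Ideal.mul_mem_left _ _ hsm
  -- domination of `S` by `O`
  have hRO : ∀ r : S, algebraMap S K r ∈ O := fun r => hSO r.2
  have hRm : ∀ r : S, r ∈ maximalIdeal S ↔ O.valuation (algebraMap S K r) < 1 := fun r =>
    mem_maximalIdeal_locAtCentre_iff hAO r
  -- MONOMIALIZE `x y s` along `v` (embedded resolution)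
  obtain ⟨uu, -, huuO, R', _, _, _, hinj, hR'O, hR'm, hlow, hup, d, z, α, u, hu, hdimR', hspan, hfact⟩ :=
    exists_localRing_monomial_of_embeddedResolution hEmb (R := S) (K := K) (E := K) Subtype.val_injective hexcS
      hdim3 O hRO hRm xR hxR0 hxRm
  -- the subring `T = S[uu]` and the image `R₂ = locAtCentre T O` of `R'`
  let T : Subring K := (Algebra.adjoin S (uu : Set K)).toSubring
  have hTO : T ≤ O.toSubring := fun w hw => huuO w hw
  have hST : S ≤ T := fun w hw => (Algebra.adjoin S (uu : Set K)).algebraMap_mem (⟨w, hw⟩ : S)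
  have hTR : ∀ w ∈ T, w ∈ Set.range (algebraMap R' K) := fun w hw => hlow w hw
  set R₂ : Subring K := locAtCentre T O with hR₂def
  have hrange : (algebraMap R' K).range = R₂ := range_eq_locAtCentre (algebraMap R' K) O T hTR hR'm hup
  obtain ⟨hreg₂, z₂, u₂, hz₂, hu₂K, hspan₂, hdim₂, hu₂⟩ :=
    regular_data_of_range_eq (algebraMap R' K) hinj R₂ hrange z hspan hdimR' u hu
  haveI := hreg₂
  have hR₂O : R₂ ≤ O.toSubring := locAtCentre_le hTO
  have hdom₂ : ∀ w : R₂, w ∈ maximalIdeal R₂ → O.valuation (w : K) < 1 := fun w hw =>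
    (mem_maximalIdeal_locAtCentre_iff hTO w).mp hw
  have hTR₂ : T ≤ R₂ := le_locAtCentre T O
  -- `z₂` is a regular system of parameters of `R₂`
  have hd' : (maximalIdeal R₂).spanFinrank = d := by
    have h := IsRegularLocalRing.spanFinrank_maximalIdeal (R := R₂)
    rw [hdim₂] at h
    exact_mod_cast h
  have hzr : IsRsopPart z₂ := isRsopPart_comp_of_rsop hd' z₂ hspan₂ id Function.injective_id
  have hz0 : ∀ i, (z₂ i : K) ≠ 0 := fun i h => hzr.ne_zero i (Subtype.ext h)
  -- `x y s = u₂ ∏ z₂^α` in `R₂`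
  let x₂ : R₂ := ⟨x, hTR₂ (hST (hAS x.2))⟩
  let y₂ : R₂ := ⟨y, hTR₂ (hST (hAS y.2))⟩
  let s₂ : R₂ := ⟨s, hTR₂ (hST s.2)⟩
  have hfact₂ : x₂ * (y₂ * s₂) = u₂ * ∏ i, z₂ i ^ α i := by
    apply Subtype.ext
    have h1 : ((x₂ * (y₂ * s₂) : R₂) : K) = (x : K) * ((y : K) * (s : K)) := rfl
    have h2 : ((u₂ * ∏ i, z₂ i ^ α i : R₂) : K) = (u₂ : K) * ∏ i, (z₂ i : K) ^ α i := by
      push_cast; rfl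
    have h3 : algebraMap S K xR = (x : K) * (y : K) * (s : K) := rfl
    have h4 : algebraMap R' K (u * ∏ i, z i ^ α i) = (u₂ : K) * ∏ i, (z₂ i : K) ^ α i := by
      rw [map_mul, map_prod, ← hu₂K]
      simp_rw [map_pow, ← hz₂]
    rw [h1, h2, ← h4, ← hfact, h3, mul_assoc]
  -- divisors of a unit times a monomial in a regular system of parameters
  have hdvdx : x₂ ∣ ∏ i, z₂ i ^ α i :=
    (hu₂.dvd_mul_left).mp ⟨y₂ * s₂, hfact₂.symm⟩
  have hdvdy : y₂ ∣ ∏ i, z₂ i ^ α i :=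
    (hu₂.dvd_mul_left).mp ⟨x₂ * s₂, by rw [← hfact₂]; ring⟩
  obtain ⟨c₁, β, hxβ⟩ := CossartPiltantMonomial.exists_eq_units_mul_prod_pow_of_dvd (fun i => hzr.prime i) α hdvdx
  obtain ⟨c₂, γ, hyγ⟩ := CossartPiltantMonomial.exists_eq_units_mul_prod_pow_of_dvd (fun i => hzr.prime i) α hdvdy
  -- `g₀ - f₀^p = x / y` is a unit times a Laurent monomial
  let u' : R₂ := (c₁ * c₂⁻¹ : R₂ˣ)
  have hu' : IsUnit u' := Units.isUnit _
  let a : Fin d → ℤ := fun i => (β i : ℤ) - (γ i : ℤ)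
  have hxK : (x : K) = ((c₁ : R₂) : K) * ∏ i, (z₂ i : K) ^ β i := by
    have := congrArg (fun w : R₂ => (w : K)) hxβ
    simpa using this
  have hyK : (y : K) = ((c₂ : R₂) : K) * ∏ i, (z₂ i : K) ^ γ i := by
    have := congrArg (fun w : R₂ => (w : K)) hyγ
    simpa using this
  have hc₂0 : ((c₂ : R₂) : K) ≠ 0 := fun h => by
    have : ((c₂ : R₂) : K) * ((↑(c₂⁻¹ : R₂ˣ) : R₂) : K) = 1 := by
      rw [← Subring.coe_mul, ← Units.val_mul, mul_inv_cancel, Units.val_one, Subring.coe_one]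
    rw [h, zero_mul] at this
    exact zero_ne_one this
  have hu'K : (u' : K) = ((c₁ : R₂) : K) * (((c₂ : R₂) : K))⁻¹ := by
    have hinv : ((↑(c₂⁻¹ : R₂ˣ) : R₂) : K) = (((c₂ : R₂) : K))⁻¹ := by
      refine (eq_inv_of_mul_eq_one_right ?_)
      rw [← Subring.coe_mul, ← Units.val_mul, mul_inv_cancel, Units.val_one, Subring.coe_one]
    change (((c₁ * c₂⁻¹ : R₂ˣ) : R₂) : K) = _
    rw [Units.val_mul, Subring.coe_mul, hinv]
  have hG : g₀ - f₀ ^ p = (u' : K) * ∏ i, (z₂ i : K) ^ (a i) := by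
    have hprod : (∏ i, (z₂ i : K) ^ (a i)) = (∏ i, (z₂ i : K) ^ β i) / ∏ i, (z₂ i : K) ^ γ i := by
      rw [← Finset.prod_div_distrib]
      refine Finset.prod_congr rfl fun i _ => ?_
      rw [zpow_sub₀ (hz0 i), zpow_natCast, zpow_natCast]
    rw [← hxy', hxK, hyK, hu'K, hprod, mul_div_mul_comm, div_eq_mul_inv]
  -- READ OFF
  have hclean : CleanRegAt p R₂.subtype g₀ :=
    cleanRegAt_of_isMin_pthPowerApprox_zpow O R₂ hR₂O hdom₂ g₀ f₀ hmin z₂ hspan₂ hdim₂ hz0 a u' hu' hG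
  -- the finitely generated model `A' = A[uu]`
  let A' : Subalgebra k K :=
    { Subring.closure ((A.toSubring : Set K) ∪ ↑uu) with
      algebraMap_mem' := fun r => Subring.subset_closure (Or.inl (A.algebraMap_mem r)) }
  have hA'sub : A'.toSubring = Subring.closure ((A.toSubring : Set K) ∪ ↑uu) := rfl
  have hAA' : A ≤ A' := fun w hw => Subring.subset_closure (Or.inl hw)
  have huuO' : ∀ w ∈ (uu : Set K), w ∈ O := fun w hw => huuO w (Algebra.subset_adjoin hw)
  have hA'O : A'.toSubring ≤ O.toSubring := by
    rw [hA'sub, Subring.closure_le]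
    rintro w (hw | hw)
    · exact hAO hw
    · exact huuO' w hw
  have hA'fg : A'.FG := by
    obtain ⟨s₀, hs₀⟩ := hAfg
    refine ⟨s₀ ∪ uu, le_antisymm ?_ ?_⟩
    · rw [Algebra.adjoin_le_iff]
      rintro w hw
      rw [Finset.coe_union] at hw
      rcases hw with hw | hw
      · exact hAA' (hs₀ ▸ Algebra.subset_adjoin hw)
      · exact Subring.subset_closure (Or.inr hw)
    · intro w hw
      change w ∈ Subring.closure ((A.toSubring : Set K) ∪ ↑uu) at hw
      have hle : Subring.closure ((A.toSubring : Set K) ∪ ↑uu) ≤ (Algebra.adjoin k (↑(s₀ ∪ uu) : Set K)).toSubring := by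
        rw [Subring.closure_le]
        rintro v (hv | hv)
        · have : v ∈ Algebra.adjoin k (s₀ : Set K) := by rw [hs₀]; exact hv
          exact Algebra.adjoin_mono (by rw [Finset.coe_union]; exact Set.subset_union_left) this
        · exact Algebra.subset_adjoin (by rw [Finset.coe_union]; exact Or.inr hv)
      exact hle hw
  -- `R₂ = locAtCentre A' O`
  have hT : T = Subring.closure ((S : Set K) ∪ ↑uu) := by
    change (Algebra.adjoin S (uu : Set K)).toSubring = _
    rw [Algebra.adjoin_eq_ring_closure]
    congr 1
    ext w
    simp only [Set.mem_union, Set.mem_range, SetLike.mem_coe]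
    constructor
    · rintro (⟨r, rfl⟩ | h)
      · exact Or.inl r.2
      · exact Or.inr h
    · rintro (h | h)
      · exact Or.inl ⟨⟨w, h⟩, rfl⟩
      · exact Or.inr h
  have hR₂A' : R₂ = locAtCentre A'.toSubring O := by
    rw [hR₂def, hT, hSdef, PfaffLine.locAtCentre_closure_locAtCentre_union, hA'sub]
  -- assemble
  refine ⟨A', hA'O, hAA', hA'fg, ?_⟩
  rw [← hR₂A']
  obtain ⟨hregR, c, hc, hform⟩ := hclean
  exact ⟨hregR, c, hc, forms_of_looseCleanForm hform⟩

end Summit.ResolutionOfSingularities.ResolutionOfSingularities.Theorems.RadicialJung.CleanModels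

end
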